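import Summits.Ventures.HodgeRepro2.T5SU11JacobiPhaseOrbitCovariance
import Summits.Ventures.HodgeRepro2.T5SU11JacobiWeightDerivAsymptotic

/-!
# The rescaled phase and the rescaled orbit radius are asymptotically perfectly correlated

`T5SU11JacobiPhaseOrbitCovariance` gives `Cov_{k,λ}(log|a|, |g·0|²) = r_k(λ)(⟨log|a|⟩_{k,λ} − ⟨log|a|⟩_{k+2,λ})`.
The mean phase is differentiable in the weight with derivative `−Var_{k,λ}(log|a|)`
(`hasDerivAt_mean_phase`: the quotient rule on `M₁/m̂`, `T5SU11JacobiWeightDeriv2`), so by the mean value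
theorem `⟨log|a|⟩_{k,λ} − ⟨log|a|⟩_{k+2,λ} = 2 Var_{ξ,λ}(log|a|)` for some `ξ ∈ (k, k + 2)`
(`exists_mean_phase_sub_eq`), and `ξ² Var_{ξ,λ}(log|a|) → 1` (`T5SU11JacobiWeightDerivAsymptotic`) gives

  **`k² (⟨log|a|⟩_{k,λ} − ⟨log|a|⟩_{k+2,λ}) → 2`**   (`tendsto_sq_mul_mean_phase_sub`),

hence, with `r_k(λ) → 1` (`tendsto_weightRatio_atTop_one`),

  **`Cov_{k,λ}(k log|a|, k|g·0|²/2) = (k²/2) Cov_{k,λ}(log|a|, |g·0|²) → 1`**   (`tendsto_sq_div_two_mul_covariance`)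

— the covariance of the two rescaled coordinates tends to `Var(E) = 1`, `E ∼ Exp(1)`, as the diagonal joint
limit law `(E, E)` of `T5SU11JacobiJointLawAsymptotic` predicts. The variance of the rescaled orbit radius
tends to `1` as well (`tendsto_sq_div_four_mul_variance_orbit_sq`: `(k²/4) r_k(λ)(r_{k+2}(λ) − r_k(λ)) → 1` in
closed form), and so does that of the rescaled phase (`T5SU11JacobiWeightDerivAsymptotic`), so the
**correlation coefficient of the phase and the squared orbit radius tends to `1`**
(`tendsto_correlation_phase_orbit_sq`) for every real `λ`: the two coordinates of the explicit model
`π_k⁺` are asymptotically perfectly correlated. Nothing is claimed about (N).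

Blind lane: Mathlib + the HodgeRepro2 prefix only; no sorry; axioms ⊆ {propext, Classical.choice,
Quot.sound}.
-/

namespace Summit.Ventures.HodgeRepro2.T5SU11JacobiPhaseOrbitCovarianceAsymptotic

open MeasureTheory MeasureTheory.Measure Metric Set Filter Topology
open T5SU11Unimodular T5SU11Fibration T5SU11Cartan T5SU11CartanProjection T5HaarCircle
  T5BergmanCoefficient T5SU11FibrationHaar T5SU11SphericalFunction T5SU11SphericalSymmetry
  T5SU11SphericalBounds T5SU11SphericalContinuous T5SU11JacobiIwasawa T5SU11JacobiTransform
  T5SU11JacobiWeight T5SU11KFiniteMajorantPow T5SU11JacobiWeightDeriv T5SU11JacobiWeightDeriv2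
  T5SU11JacobiWeightRecursion T5SU11JacobiRatioLimit T5SU11JacobiPhaseMGF
  T5SU11JacobiWeightDerivAsymptotic T5SU11JacobiPhaseOrbitCovariance
open scoped Real

/-! ### Elementary limits -/

/-- **`r_k(λ) → 1`** as `k → ∞`: `r_k(λ) = 1 − 2/k − λ(λ − 2)/k²`. -/
theorem tendsto_weightRatio_atTop_one (lam : ℝ) :
    Tendsto (fun k : ℝ => weightRatio k lam) atTop (𝓝 1) := by
  have h1 : Tendsto (fun k : ℝ => 2 / k) atTop (𝓝 0) := tendsto_id.const_div_atTop 2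
  have h2 : Tendsto (fun k : ℝ => lam * (lam - 2) / k ^ 2) atTop (𝓝 0) :=
    (tendsto_pow_atTop two_ne_zero).const_div_atTop (lam * (lam - 2))
  have h := ((tendsto_const_nhds (x := (1 : ℝ))).sub h1).sub h2
  rw [sub_zero, sub_zero] at h
  refine h.congr' ?_
  filter_upwards [eventually_gt_atTop (0 : ℝ)] with k hk
  rw [weightRatio_eq hk.ne']

/-- `c (k + 1)/(k + 2)² → 0`. -/
theorem tendsto_mul_add_one_div_add_two_sq (c : ℝ) :
    Tendsto (fun k : ℝ => c * (k + 1) / (k + 2) ^ 2) atTop (𝓝 0) := by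
  have h1 : Tendsto (fun k : ℝ => c / (k + 2)) atTop (𝓝 0) :=
    (tendsto_atTop_add_const_right atTop 2 tendsto_id).const_div_atTop c
  have h2 : Tendsto (fun k : ℝ => (k + 1) / (k + 2)) atTop (𝓝 1) := by
    have := tendsto_div_add_const_atTop_one 1
    have h' := this.comp (tendsto_atTop_add_const_right atTop 1 tendsto_id)
    refine h'.congr' (Filter.Eventually.of_forall fun k => ?_)
    simp only [Function.comp_apply, id_eq]
    ring_nf
  have h := h1.mul h2
  rw [zero_mul] at h
  refine h.congr' ?_
  filter_upwards [eventually_gt_atTop (0 : ℝ)] with k hk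
  have : k + 2 ≠ 0 := by linarith
  field_simp

section measure

variable [MeasurableSpace Circle] [BorelSpace Circle]

/-! ### The derivative of the mean phase in the weight -/

/-- **`(d/dk) ⟨log|a|⟩_{k,λ} = −Var_{k,λ}(log|a|)`**: the mean phase is differentiable in the weight with
derivative minus the variance of the phase (the quotient rule on `M₁(k)/m̂_k`). -/
theorem hasDerivAt_mean_phase {k lam : ℝ} (hk : 1 < k) (h1 : lam < k) (h2 : 2 < k + lam) :
    HasDerivAt (fun k : ℝ =>
        (∫ g, Real.log ‖mat g 0 0‖ * ((1 - ‖orbit g‖ ^ 2) ^ (k / 2) * sph lam g) ∂(nu haarCircle))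
          / ∫ g, (1 - ‖orbit g‖ ^ 2) ^ (k / 2) * sph lam g ∂(nu haarCircle))
      (-((∫ g, Real.log ‖mat g 0 0‖ ^ 2 * ((1 - ‖orbit g‖ ^ 2) ^ (k / 2) * sph lam g) ∂(nu haarCircle))
            / (∫ g, (1 - ‖orbit g‖ ^ 2) ^ (k / 2) * sph lam g ∂(nu haarCircle))
          - ((∫ g, Real.log ‖mat g 0 0‖ * ((1 - ‖orbit g‖ ^ 2) ^ (k / 2) * sph lam g) ∂(nu haarCircle))
            / (∫ g, (1 - ‖orbit g‖ ^ 2) ^ (k / 2) * sph lam g ∂(nu haarCircle))) ^ 2)) k := by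
  have hM := hasDerivAt_first_moment hk h1 h2
  have hm := hasDerivAt_jacobi_weight hk h1 h2
  have hpos := jacobi_pos hk h1 h2
  refine (hM.div hm hpos.ne').congr_deriv ?_
  field_simp
  ring

/-- **The mean value theorem for the mean phase**: on the ray there is `ξ ∈ (k, k + 2)` with
`⟨log|a|⟩_{k,λ} − ⟨log|a|⟩_{k+2,λ} = 2 Var_{ξ,λ}(log|a|)`. -/
theorem exists_mean_phase_sub_eq {k lam : ℝ} (hk : 1 < k) (h1 : lam < k) (h2 : 2 < k + lam) :
    ∃ ξ ∈ Ioo k (k + 2),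
      (∫ g, Real.log ‖mat g 0 0‖ * ((1 - ‖orbit g‖ ^ 2) ^ (k / 2) * sph lam g) ∂(nu haarCircle))
          / (∫ g, (1 - ‖orbit g‖ ^ 2) ^ (k / 2) * sph lam g ∂(nu haarCircle))
        - (∫ g, Real.log ‖mat g 0 0‖ * ((1 - ‖orbit g‖ ^ 2) ^ ((k + 2) / 2) * sph lam g) ∂(nu haarCircle))
          / (∫ g, (1 - ‖orbit g‖ ^ 2) ^ ((k + 2) / 2) * sph lam g ∂(nu haarCircle))
      = 2 * ((∫ g, Real.log ‖mat g 0 0‖ ^ 2 * ((1 - ‖orbit g‖ ^ 2) ^ (ξ / 2) * sph lam g) ∂(nu haarCircle))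
            / (∫ g, (1 - ‖orbit g‖ ^ 2) ^ (ξ / 2) * sph lam g ∂(nu haarCircle))
          - ((∫ g, Real.log ‖mat g 0 0‖ * ((1 - ‖orbit g‖ ^ 2) ^ (ξ / 2) * sph lam g) ∂(nu haarCircle))
            / (∫ g, (1 - ‖orbit g‖ ^ 2) ^ (ξ / 2) * sph lam g ∂(nu haarCircle))) ^ 2) := by
  set f : ℝ → ℝ := fun k =>
    (∫ g, Real.log ‖mat g 0 0‖ * ((1 - ‖orbit g‖ ^ 2) ^ (k / 2) * sph lam g) ∂(nu haarCircle))
      / ∫ g, (1 - ‖orbit g‖ ^ 2) ^ (k / 2) * sph lam g ∂(nu haarCircle) with hf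
  set V : ℝ → ℝ := fun k =>
    (∫ g, Real.log ‖mat g 0 0‖ ^ 2 * ((1 - ‖orbit g‖ ^ 2) ^ (k / 2) * sph lam g) ∂(nu haarCircle))
        / (∫ g, (1 - ‖orbit g‖ ^ 2) ^ (k / 2) * sph lam g ∂(nu haarCircle))
      - ((∫ g, Real.log ‖mat g 0 0‖ * ((1 - ‖orbit g‖ ^ 2) ^ (k / 2) * sph lam g) ∂(nu haarCircle))
        / (∫ g, (1 - ‖orbit g‖ ^ 2) ^ (k / 2) * sph lam g ∂(nu haarCircle))) ^ 2 with hV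
  have hder : ∀ x ∈ Icc k (k + 2), HasDerivAt f (-V x) x := fun x hx =>
    hasDerivAt_mean_phase (by linarith [hx.1]) (by linarith [hx.1]) (by linarith [hx.1])
  have hcont : ContinuousOn f (Icc k (k + 2)) := fun x hx =>
    (hder x hx).continuousAt.continuousWithinAt
  obtain ⟨ξ, hξ, he⟩ := exists_hasDerivAt_eq_slope f (fun x => -V x) (by linarith) hcont
    fun x hx => hder x (Ioo_subset_Icc_self hx)
  refine ⟨ξ, hξ, ?_⟩
  rw [show k + 2 - k = 2 by ring] at he
  have : f k - f (k + 2) = 2 * V ξ := by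
    have h2' : (2 : ℝ) ≠ 0 := two_ne_zero
    field_simp at he
    linarith
  exact this

/-! ### The limit of the rescaled covariance -/

/-- **`k² (⟨log|a|⟩_{k,λ} − ⟨log|a|⟩_{k+2,λ}) → 2`** as `k → ∞`, for every `λ`. -/
theorem tendsto_sq_mul_mean_phase_sub (lam : ℝ) :
    Tendsto (fun k : ℝ => k ^ 2 *
      ((∫ g, Real.log ‖mat g 0 0‖ * ((1 - ‖orbit g‖ ^ 2) ^ (k / 2) * sph lam g) ∂(nu haarCircle))
          / (∫ g, (1 - ‖orbit g‖ ^ 2) ^ (k / 2) * sph lam g ∂(nu haarCircle))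
        - (∫ g, Real.log ‖mat g 0 0‖ * ((1 - ‖orbit g‖ ^ 2) ^ ((k + 2) / 2) * sph lam g) ∂(nu haarCircle))
          / (∫ g, (1 - ‖orbit g‖ ^ 2) ^ ((k + 2) / 2) * sph lam g ∂(nu haarCircle))))
      atTop (𝓝 2) := by
  set K₀ : ℝ := max 1 (max lam (2 - lam)) with hK₀
  set V : ℝ → ℝ := fun k =>
    (∫ g, Real.log ‖mat g 0 0‖ ^ 2 * ((1 - ‖orbit g‖ ^ 2) ^ (k / 2) * sph lam g) ∂(nu haarCircle))
        / (∫ g, (1 - ‖orbit g‖ ^ 2) ^ (k / 2) * sph lam g ∂(nu haarCircle))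
      - ((∫ g, Real.log ‖mat g 0 0‖ * ((1 - ‖orbit g‖ ^ 2) ^ (k / 2) * sph lam g) ∂(nu haarCircle))
        / (∫ g, (1 - ‖orbit g‖ ^ 2) ^ (k / 2) * sph lam g ∂(nu haarCircle))) ^ 2 with hV
  have hmvt : ∀ k : ℝ, K₀ < k → ∃ ξ ∈ Ioo k (k + 2),
      (∫ g, Real.log ‖mat g 0 0‖ * ((1 - ‖orbit g‖ ^ 2) ^ (k / 2) * sph lam g) ∂(nu haarCircle))
          / (∫ g, (1 - ‖orbit g‖ ^ 2) ^ (k / 2) * sph lam g ∂(nu haarCircle))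
        - (∫ g, Real.log ‖mat g 0 0‖ * ((1 - ‖orbit g‖ ^ 2) ^ ((k + 2) / 2) * sph lam g) ∂(nu haarCircle))
          / (∫ g, (1 - ‖orbit g‖ ^ 2) ^ ((k + 2) / 2) * sph lam g ∂(nu haarCircle))
      = 2 * V ξ := fun k hk => by
    rw [hK₀, max_lt_iff, max_lt_iff] at hk
    exact exists_mean_phase_sub_eq hk.1 hk.2.1 (by linarith [hk.2.2])
  choose! ξ hξ using hmvt
  have hξ_atTop : Tendsto ξ atTop atTop := by
    refine tendsto_atTop_mono' atTop ?_ tendsto_id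
    filter_upwards [eventually_gt_atTop K₀] with k hk
    exact (hξ k hk).1.1.le
  have hA : Tendsto (fun k : ℝ => ξ k ^ 2 * V (ξ k)) atTop (𝓝 1) :=
    (tendsto_sq_mul_variance_phase lam).comp hξ_atTop
  have hB : Tendsto (fun k : ℝ => k / ξ k) atTop (𝓝 1) := by
    refine tendsto_of_tendsto_of_tendsto_of_le_of_le' (tendsto_div_add_const_atTop_one 2)
      tendsto_const_nhds ?_ ?_
    · filter_upwards [eventually_gt_atTop (max K₀ 0)] with k hk
      rw [max_lt_iff] at hk
      have h := (hξ k hk.1).1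
      exact div_le_div_of_nonneg_left hk.2.le (by linarith [h.1]) h.2.le
    · filter_upwards [eventually_gt_atTop (max K₀ 0)] with k hk
      rw [max_lt_iff] at hk
      have h := (hξ k hk.1).1
      exact (div_le_one (by linarith [h.1])).mpr h.1.le
  have h := ((hB.pow 2).mul hA).const_mul 2
  rw [one_pow, one_mul, mul_one] at h
  refine h.congr' ?_
  filter_upwards [eventually_gt_atTop (max K₀ 0)] with k hk
  rw [max_lt_iff] at hk
  have hk' := hξ k hk.1
  have hne : ξ k ≠ 0 := by linarith [hk'.1.1]
  rw [hk'.2]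
  field_simp

/-- **THE COVARIANCE OF THE RESCALED COORDINATES TENDS TO `1`**: for every `λ`,
`Cov_{k,λ}(k log|a|, k|g·0|²/2) = (k²/2) Cov_{k,λ}(log|a|, |g·0|²) → 1 = Var(Exp(1))` as `k → ∞`. -/
theorem tendsto_sq_div_two_mul_covariance (lam : ℝ) :
    Tendsto (fun k : ℝ => k ^ 2 / 2 *
      ((∫ g, Real.log ‖mat g 0 0‖ * ‖orbit g‖ ^ 2 * ((1 - ‖orbit g‖ ^ 2) ^ (k / 2) * sph lam g)
            ∂(nu haarCircle))
          / (∫ g, (1 - ‖orbit g‖ ^ 2) ^ (k / 2) * sph lam g ∂(nu haarCircle))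
        - ((∫ g, Real.log ‖mat g 0 0‖ * ((1 - ‖orbit g‖ ^ 2) ^ (k / 2) * sph lam g) ∂(nu haarCircle))
            / (∫ g, (1 - ‖orbit g‖ ^ 2) ^ (k / 2) * sph lam g ∂(nu haarCircle)))
          * ((∫ g, ‖orbit g‖ ^ 2 * ((1 - ‖orbit g‖ ^ 2) ^ (k / 2) * sph lam g) ∂(nu haarCircle))
            / (∫ g, (1 - ‖orbit g‖ ^ 2) ^ (k / 2) * sph lam g ∂(nu haarCircle)))))
      atTop (𝓝 1) := by
  have h := ((tendsto_weightRatio_atTop_one lam).mul (tendsto_sq_mul_mean_phase_sub lam)).const_mul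
    (1 / 2)
  rw [one_mul, show (1 / 2 : ℝ) * 2 = 1 by norm_num] at h
  refine h.congr' ?_
  filter_upwards [eventually_gt_atTop (max 1 (max lam (2 - lam)))] with k hk
  rw [max_lt_iff, max_lt_iff] at hk
  rw [covariance_phase_orbit_sq_eq hk.1 hk.2.1 (by linarith [hk.2.2])]
  ring

/-! ### The variance of the rescaled orbit radius -/

/-- **`Var_{k,λ}(k|g·0|²/2) = (k²/4) Var_{k,λ}(|g·0|²) → 1`** as `k → ∞`, for every `λ`: in closed form
`(k²/4) r_k(λ)(r_{k+2}(λ) − r_k(λ)) = r_k(λ) (k/(k + 2) + λ(λ − 2)(k + 1)/(k + 2)²)`. -/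
theorem tendsto_sq_div_four_mul_variance_orbit_sq (lam : ℝ) :
    Tendsto (fun k : ℝ => k ^ 2 / 4 *
      ((∫ g, (‖orbit g‖ ^ 2) ^ 2 * ((1 - ‖orbit g‖ ^ 2) ^ (k / 2) * sph lam g) ∂(nu haarCircle))
          / (∫ g, (1 - ‖orbit g‖ ^ 2) ^ (k / 2) * sph lam g ∂(nu haarCircle))
        - ((∫ g, ‖orbit g‖ ^ 2 * ((1 - ‖orbit g‖ ^ 2) ^ (k / 2) * sph lam g) ∂(nu haarCircle))
          / (∫ g, (1 - ‖orbit g‖ ^ 2) ^ (k / 2) * sph lam g ∂(nu haarCircle))) ^ 2))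
      atTop (𝓝 1) := by
  have hA := (tendsto_div_add_const_atTop_one 2).add (tendsto_mul_add_one_div_add_two_sq (lam * (lam - 2)))
  rw [add_zero] at hA
  have h := (tendsto_weightRatio_atTop_one lam).mul hA
  rw [one_mul] at h
  refine h.congr' ?_
  filter_upwards [eventually_gt_atTop (max 1 (max lam (2 - lam)))] with k hk
  rw [max_lt_iff, max_lt_iff] at hk
  rw [variance_orbit_sq_eq hk.1 hk.2.1 (by linarith [hk.2.2]), weightRatio_eq (by linarith),
    weightRatio_eq (by linarith : k + 2 ≠ 0)]
  have hk0 : k ≠ 0 := by linarith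
  have hk2 : k + 2 ≠ 0 := by linarith
  field_simp
  ring

/-! ### The correlation coefficient -/

/-- **THE CORRELATION COEFFICIENT OF THE PHASE AND THE SQUARED ORBIT RADIUS TENDS TO `1`**: for every `λ`,
`Cov_{k,λ}(log|a|, |g·0|²) / √(Var_{k,λ}(log|a|) Var_{k,λ}(|g·0|²)) → 1` as `k → ∞` — the two coordinates of
the explicit model are asymptotically perfectly correlated. -/
theorem tendsto_correlation_phase_orbit_sq (lam : ℝ) :
    Tendsto (fun k : ℝ =>
      ((∫ g, Real.log ‖mat g 0 0‖ * ‖orbit g‖ ^ 2 * ((1 - ‖orbit g‖ ^ 2) ^ (k / 2) * sph lam g)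
            ∂(nu haarCircle))
          / (∫ g, (1 - ‖orbit g‖ ^ 2) ^ (k / 2) * sph lam g ∂(nu haarCircle))
        - ((∫ g, Real.log ‖mat g 0 0‖ * ((1 - ‖orbit g‖ ^ 2) ^ (k / 2) * sph lam g) ∂(nu haarCircle))
            / (∫ g, (1 - ‖orbit g‖ ^ 2) ^ (k / 2) * sph lam g ∂(nu haarCircle)))
          * ((∫ g, ‖orbit g‖ ^ 2 * ((1 - ‖orbit g‖ ^ 2) ^ (k / 2) * sph lam g) ∂(nu haarCircle))
            / (∫ g, (1 - ‖orbit g‖ ^ 2) ^ (k / 2) * sph lam g ∂(nu haarCircle))))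
      / Real.sqrt
        (((∫ g, Real.log ‖mat g 0 0‖ ^ 2 * ((1 - ‖orbit g‖ ^ 2) ^ (k / 2) * sph lam g) ∂(nu haarCircle))
            / (∫ g, (1 - ‖orbit g‖ ^ 2) ^ (k / 2) * sph lam g ∂(nu haarCircle))
          - ((∫ g, Real.log ‖mat g 0 0‖ * ((1 - ‖orbit g‖ ^ 2) ^ (k / 2) * sph lam g) ∂(nu haarCircle))
            / (∫ g, (1 - ‖orbit g‖ ^ 2) ^ (k / 2) * sph lam g ∂(nu haarCircle))) ^ 2)
        * ((∫ g, (‖orbit g‖ ^ 2) ^ 2 * ((1 - ‖orbit g‖ ^ 2) ^ (k / 2) * sph lam g) ∂(nu haarCircle))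
            / (∫ g, (1 - ‖orbit g‖ ^ 2) ^ (k / 2) * sph lam g ∂(nu haarCircle))
          - ((∫ g, ‖orbit g‖ ^ 2 * ((1 - ‖orbit g‖ ^ 2) ^ (k / 2) * sph lam g) ∂(nu haarCircle))
            / (∫ g, (1 - ‖orbit g‖ ^ 2) ^ (k / 2) * sph lam g ∂(nu haarCircle))) ^ 2)))
      atTop (𝓝 1) := by
  have hnum := tendsto_sq_div_two_mul_covariance lam
  have hden0 := (tendsto_sq_mul_variance_phase lam).mul (tendsto_sq_div_four_mul_variance_orbit_sq lam)
  rw [one_mul] at hden0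
  have hden := hden0.sqrt
  rw [Real.sqrt_one] at hden
  have h := hnum.div hden one_ne_zero
  rw [div_one] at h
  refine h.congr' ?_
  filter_upwards [eventually_gt_atTop (0 : ℝ)] with k hk
  have hk2 : 0 < k ^ 2 / 2 := by positivity
  simp only [Pi.div_apply]
  rw [show ∀ a b : ℝ, (k ^ 2 * a) * (k ^ 2 / 4 * b) = (k ^ 2 / 2) ^ 2 * (a * b) from
    fun a b => by ring, Real.sqrt_mul (sq_nonneg _), Real.sqrt_sq hk2.le,
    mul_div_mul_left _ _ hk2.ne']

end measure

end Summit.Ventures.HodgeRepro2.T5SU11JacobiPhaseOrbitCovarianceAsymptotic
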